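import Summits.ValiantsHypothesis.ValiantsHypothesis.Theorems.LacunarySymmetroidMatrixDescartesFiniteSectorKernelTableTwo
import Summits.ValiantsHypothesis.ValiantsHypothesis.Theorems.LacunarySymmetroidMatrixDescartesFiniteSectorSectorCeilingEightSix
import Summits.ValiantsHypothesis.ValiantsHypothesis.Theorems.LacunarySymmetroidMatrixDescartesFiniteSectorSectorCeilingEighteenFive
import Summits.ValiantsHypothesis.ValiantsHypothesis.Theorems.LacunarySymmetroidMatrixDescartesFiniteSectorSectorCeilingFifteenFive
import Summits.ValiantsHypothesis.ValiantsHypothesis.Theorems.LacunarySymmetroidMatrixDescartesFiniteSectorSectorCeilingFiftyFour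
import Summits.ValiantsHypothesis.ValiantsHypothesis.Theorems.LacunarySymmetroidMatrixDescartesFiniteSectorSectorCeilingFiftyeightFour
import Summits.ValiantsHypothesis.ValiantsHypothesis.Theorems.LacunarySymmetroidMatrixDescartesFiniteSectorSectorCeilingFiftyfiveFour
import Summits.ValiantsHypothesis.ValiantsHypothesis.Theorems.LacunarySymmetroidMatrixDescartesFiniteSectorSectorCeilingFiftyfourFour
import Summits.ValiantsHypothesis.ValiantsHypothesis.Theorems.LacunarySymmetroidMatrixDescartesFiniteSectorSectorCeilingFiftynineFour
import Summits.ValiantsHypothesis.ValiantsHypothesis.Theorems.LacunarySymmetroidMatrixDescartesFiniteSectorSectorCeilingFiftyoneFour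
import Summits.ValiantsHypothesis.ValiantsHypothesis.Theorems.LacunarySymmetroidMatrixDescartesFiniteSectorSectorCeilingFiftysevenFour
import Summits.ValiantsHypothesis.ValiantsHypothesis.Theorems.LacunarySymmetroidMatrixDescartesFiniteSectorSectorCeilingFiftysixFour
import Summits.ValiantsHypothesis.ValiantsHypothesis.Theorems.LacunarySymmetroidMatrixDescartesFiniteSectorSectorCeilingFiftythreeFour
import Summits.ValiantsHypothesis.ValiantsHypothesis.Theorems.LacunarySymmetroidMatrixDescartesFiniteSectorSectorCeilingFiftytwoFour
import Summits.ValiantsHypothesis.ValiantsHypothesis.Theorems.LacunarySymmetroidMatrixDescartesFiniteSectorSectorCeilingFortyeightFour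
import Summits.ValiantsHypothesis.ValiantsHypothesis.Theorems.LacunarySymmetroidMatrixDescartesFiniteSectorSectorCeilingFortyfiveFour
import Summits.ValiantsHypothesis.ValiantsHypothesis.Theorems.LacunarySymmetroidMatrixDescartesFiniteSectorSectorCeilingFortyfourFour
import Summits.ValiantsHypothesis.ValiantsHypothesis.Theorems.LacunarySymmetroidMatrixDescartesFiniteSectorSectorCeilingFortynineFour
import Summits.ValiantsHypothesis.ValiantsHypothesis.Theorems.LacunarySymmetroidMatrixDescartesFiniteSectorSectorCeilingFortyoneFour
import Summits.ValiantsHypothesis.ValiantsHypothesis.Theorems.LacunarySymmetroidMatrixDescartesFiniteSectorSectorCeilingFortysevenFour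
import Summits.ValiantsHypothesis.ValiantsHypothesis.Theorems.LacunarySymmetroidMatrixDescartesFiniteSectorSectorCeilingFortysixFour
import Summits.ValiantsHypothesis.ValiantsHypothesis.Theorems.LacunarySymmetroidMatrixDescartesFiniteSectorSectorCeilingFortythreeFour
import Summits.ValiantsHypothesis.ValiantsHypothesis.Theorems.LacunarySymmetroidMatrixDescartesFiniteSectorSectorCeilingFortytwoFour
import Summits.ValiantsHypothesis.ValiantsHypothesis.Theorems.LacunarySymmetroidMatrixDescartesFiniteSectorSectorCeilingNineteenFive
import Summits.ValiantsHypothesis.ValiantsHypothesis.Theorems.LacunarySymmetroidMatrixDescartesFiniteSectorSectorCeilingSeventeenFive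
import Summits.ValiantsHypothesis.ValiantsHypothesis.Theorems.LacunarySymmetroidMatrixDescartesFiniteSectorStampCeilingElevenSix
import Summits.ValiantsHypothesis.ValiantsHypothesis.Theorems.LacunarySymmetroidMatrixDescartesFiniteSectorStampCeilingFiftyFour
import Summits.ValiantsHypothesis.ValiantsHypothesis.Theorems.LacunarySymmetroidMatrixDescartesFiniteSectorStampCeilingFiftyeightFour
import Summits.ValiantsHypothesis.ValiantsHypothesis.Theorems.LacunarySymmetroidMatrixDescartesFiniteSectorStampCeilingFiftyfiveFour
import Summits.ValiantsHypothesis.ValiantsHypothesis.Theorems.LacunarySymmetroidMatrixDescartesFiniteSectorStampCeilingFiftyfourFour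
import Summits.ValiantsHypothesis.ValiantsHypothesis.Theorems.LacunarySymmetroidMatrixDescartesFiniteSectorStampCeilingFiftynineFour
import Summits.ValiantsHypothesis.ValiantsHypothesis.Theorems.LacunarySymmetroidMatrixDescartesFiniteSectorStampCeilingFiftyoneFour
import Summits.ValiantsHypothesis.ValiantsHypothesis.Theorems.LacunarySymmetroidMatrixDescartesFiniteSectorStampCeilingFiftysevenFour
import Summits.ValiantsHypothesis.ValiantsHypothesis.Theorems.LacunarySymmetroidMatrixDescartesFiniteSectorStampCeilingFiftysixFour
import Summits.ValiantsHypothesis.ValiantsHypothesis.Theorems.LacunarySymmetroidMatrixDescartesFiniteSectorStampCeilingFiftythreeFour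
import Summits.ValiantsHypothesis.ValiantsHypothesis.Theorems.LacunarySymmetroidMatrixDescartesFiniteSectorStampCeilingFiftytwoFour
import Summits.ValiantsHypothesis.ValiantsHypothesis.Theorems.LacunarySymmetroidMatrixDescartesFiniteSectorStampCeilingFortyeightFour
import Summits.ValiantsHypothesis.ValiantsHypothesis.Theorems.LacunarySymmetroidMatrixDescartesFiniteSectorStampCeilingFortyfiveFour
import Summits.ValiantsHypothesis.ValiantsHypothesis.Theorems.LacunarySymmetroidMatrixDescartesFiniteSectorStampCeilingFortyfourFour
import Summits.ValiantsHypothesis.ValiantsHypothesis.Theorems.LacunarySymmetroidMatrixDescartesFiniteSectorStampCeilingFortynineFour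
import Summits.ValiantsHypothesis.ValiantsHypothesis.Theorems.LacunarySymmetroidMatrixDescartesFiniteSectorStampCeilingFortyoneFour
import Summits.ValiantsHypothesis.ValiantsHypothesis.Theorems.LacunarySymmetroidMatrixDescartesFiniteSectorStampCeilingFortysevenFour
import Summits.ValiantsHypothesis.ValiantsHypothesis.Theorems.LacunarySymmetroidMatrixDescartesFiniteSectorStampCeilingFortysixFour
import Summits.ValiantsHypothesis.ValiantsHypothesis.Theorems.LacunarySymmetroidMatrixDescartesFiniteSectorStampCeilingFortythreeFour
import Summits.ValiantsHypothesis.ValiantsHypothesis.Theorems.LacunarySymmetroidMatrixDescartesFiniteSectorStampCeilingFortytwoFour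
import Summits.ValiantsHypothesis.ValiantsHypothesis.Theorems.LacunarySymmetroidMatrixDescartesFiniteSectorStampCeilingSixSeven
import Summits.ValiantsHypothesis.ValiantsHypothesis.Theorems.LacunarySymmetroidMatrixDescartesFiniteSectorStampCeilingSixtyFour
import Summits.ValiantsHypothesis.ValiantsHypothesis.Theorems.LacunarySymmetroidMatrixDescartesFiniteSectorStampCeilingTenSix
import Summits.ValiantsHypothesis.ValiantsHypothesis.Theorems.LacunarySymmetroidMatrixDescartesFiniteSectorStampCeilingTwentyFive
import Summits.ValiantsHypothesis.ValiantsHypothesis.Theorems.LacunarySymmetroidMatrixDescartesFiniteSectorStampCeilingTwentyoneFive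
import Summits.ValiantsHypothesis.ValiantsHypothesis.Theorems.LacunarySymmetroidMatrixDescartesFiniteSectorStampCeilingTwoThirteen

/-!
# `MatrixDescartes` — line «finite»: the KERNEL TABLE of the finite registers, by name — successor III (columns `K = 4 … 7`, row `m = 2`)

HONEST FRAMING.  Object-search cell `pub-symmetroid`, seat val-sym-door-p5 g12.  HELPER of the crux item `stmt-ValiantsHypothesis-18050` with NO closure claim: pure by-name
bookkeeping assembling LANDED cells of line «finite» (`HypRootLawAt m K σ(m,K)` = sector ceilings, `StampLawAt m K n(m,K−1)` = stamp ceilings) into column / row theorems;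
APPEND-STYLE SUCCESSOR of `…FiniteSectorKernelTableTwo` (val-sym-door-p5 g11, untouched; its columns stop at `m ≤ 40` (K = 4), `14 / 19` (K = 5), `7 / 9` (K = 6), `4 / 5`
(K = 7), row `m = 2` at `K ≤ 10 / 12`), extended by the cells of seats g11/g12 (K = 4 column to `m = 59 / 60`, K = 5 to `m = 15 / 21`, K = 6 to `8 / 11`, K = 7 stamp
register to `6`, row `m = 2` stamp register to `K = 13`).  Every value is an UPPER side for ALL supports; lower sides are not claimed; RECORD-tier evidence for
Conjecture Σ (`σ(m,K) = 2·n(m,K−1)`, located with 0 violations at every cell listed).  Nothing here bears on the crux (asymptotic in `K`), on the doors, or on `VP ≠ VNP`.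
[folklore] Bookkeeping over kernel-certified finite enumerations (postage-stamp numbers, Guy UPINT C12); no citation is load-bearing.
-/

-- `Summit.ValiantsHypothesis.ValiantsHypothesis.…` repeats a component by the D-0017 layout
-- (single-conjunct summit), which the `dupNamespace` linter flags; the name is mandated.
set_option linter.dupNamespace false

namespace Summit.ValiantsHypothesis.ValiantsHypothesis.Theorems.LacunarySymmetroidMatrixDescartes.FiniteSector

/-- **The `K = 4` column, sector register, by name, to `m = 59`**: `η(m,4) ≤ σ(m,4) = 2·n(m,3)` for every `2 ≤ m ≤ 59`. [folklore] -/
theorem hypRootLawAt_column_four'' (m : ℕ) (hm : 2 ≤ m) (hM : m ≤ 59) :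
    HypRootLawAt m 4 (([16, 30, 52, 70, 104, 138, 178, 224, 292, 344, 424, 518, 604, 708, 836, 952, 1096, 1266, 1428, 1610, 1804, 2024, 2254, 2508, 2764, 3048, 3356, 3682, 4020, 4376, 4764, 5168, 5602, 6040, 6512, 7016, 7544, 8086, 8652, 9256, 9882, 10544, 11212, 11920, 12668, 13446, 14240, 15064, 15932, 16828, 17766, 18712, 19704, 20744, 21820, 22914, 24044, 25224] : List ℕ).getD (m - 2) 0) := by
  interval_cases m
  · exact hypRootLawAt_two_four_16
  · exact hypRootLawAt_three_four_30
  · exact hypRootLawAt_four_four_52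
  · exact hypRootLawAt_five_four_70
  · exact hypRootLawAt_six_four_104
  · exact hypRootLawAt_seven_four_138
  · exact hypRootLawAt_eight_four_178
  · exact hypRootLawAt_nine_four_224
  · exact hypRootLawAt_ten_four_292
  · exact hypRootLawAt_eleven_four_344
  · exact hypRootLawAt_twelve_four_424
  · exact hypRootLawAt_thirteen_four_518
  · exact hypRootLawAt_fourteen_four_604
  · exact hypRootLawAt_fifteen_four_708
  · exact hypRootLawAt_sixteen_four_836
  · exact hypRootLawAt_seventeen_four_952
  · exact hypRootLawAt_eighteen_four_1096
  · exact hypRootLawAt_nineteen_four_1266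
  · exact hypRootLawAt_twenty_four_1428
  · exact hypRootLawAt_twentyone_four_1610
  · exact hypRootLawAt_twentytwo_four_1804
  · exact hypRootLawAt_twentythree_four_2024
  · exact hypRootLawAt_twentyfour_four_2254
  · exact hypRootLawAt_twentyfive_four_2508
  · exact hypRootLawAt_twentysix_four_2764
  · exact hypRootLawAt_twentyseven_four_3048
  · exact hypRootLawAt_twentyeight_four_3356
  · exact hypRootLawAt_twentynine_four_3682
  · exact hypRootLawAt_thirty_four_4020
  · exact hypRootLawAt_thirtyone_four_4376
  · exact hypRootLawAt_thirtytwo_four_4764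
  · exact hypRootLawAt_thirtythree_four_5168
  · exact hypRootLawAt_thirtyfour_four_5602
  · exact hypRootLawAt_thirtyfive_four_6040
  · exact hypRootLawAt_thirtysix_four_6512
  · exact hypRootLawAt_thirtyseven_four_7016
  · exact hypRootLawAt_thirtyeight_four_7544
  · exact hypRootLawAt_thirtynine_four_8086
  · exact hypRootLawAt_forty_four_8652
  · exact hypRootLawAt_fortyone_four_9256
  · exact hypRootLawAt_fortytwo_four_9882
  · exact hypRootLawAt_fortythree_four_10544
  · exact hypRootLawAt_fortyfour_four_11212
  · exact hypRootLawAt_fortyfive_four_11920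
  · exact hypRootLawAt_fortysix_four_12668
  · exact hypRootLawAt_fortyseven_four_13446
  · exact hypRootLawAt_fortyeight_four_14240
  · exact hypRootLawAt_fortynine_four_15064
  · exact hypRootLawAt_fifty_four_15932
  · exact hypRootLawAt_fiftyone_four_16828
  · exact hypRootLawAt_fiftytwo_four_17766
  · exact hypRootLawAt_fiftythree_four_18712
  · exact hypRootLawAt_fiftyfour_four_19704
  · exact hypRootLawAt_fiftyfive_four_20744
  · exact hypRootLawAt_fiftysix_four_21820
  · exact hypRootLawAt_fiftyseven_four_22914
  · exact hypRootLawAt_fiftyeight_four_24044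
  · exact hypRootLawAt_fiftynine_four_25224

/-- **The `K = 4` column, stamp register, by name, to `m = 60`**: `ν(m,4) ≤ n(m,3)` for every `2 ≤ m ≤ 60` (three-denomination postage-stamp numbers). [folklore] -/
theorem stampLawAt_column_four'' (m : ℕ) (hm : 2 ≤ m) (hM : m ≤ 60) :
    StampLawAt m 4 (([8, 15, 26, 35, 52, 69, 89, 112, 146, 172, 212, 259, 302, 354, 418, 476, 548, 633, 714, 805, 902, 1012, 1127, 1254, 1382, 1524, 1678, 1841, 2010, 2188, 2382, 2584, 2801, 3020, 3256, 3508, 3772, 4043, 4326, 4628, 4941, 5272, 5606, 5960, 6334, 6723, 7120, 7532, 7966, 8414, 8883, 9356, 9852, 10372, 10910, 11457, 12022, 12612, 13219] : List ℕ).getD (m - 2) 0) := by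
  interval_cases m
  · exact stampLawAt_two_four
  · exact stampLawAt_three_four
  · exact stampLawAt_four_four
  · exact stampLawAt_five_four
  · exact stampLawAt_six_four
  · exact stampLawAt_seven_four
  · exact stampLawAt_eight_four
  · exact stampLawAt_nine_four
  · exact stampLawAt_ten_four
  · exact stampLawAt_eleven_four
  · exact stampLawAt_twelve_four
  · exact stampLawAt_thirteen_four
  · exact stampLawAt_fourteen_four
  · exact stampLawAt_fifteen_four
  · exact stampLawAt_sixteen_four
  · exact stampLawAt_seventeen_four
  · exact stampLawAt_eighteen_four
  · exact stampLawAt_nineteen_four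
  · exact stampLawAt_twenty_four
  · exact stampLawAt_twentyone_four
  · exact stampLawAt_twentytwo_four
  · exact stampLawAt_twentythree_four
  · exact stampLawAt_twentyfour_four
  · exact stampLawAt_twentyfive_four
  · exact stampLawAt_twentysix_four
  · exact stampLawAt_twentyseven_four
  · exact stampLawAt_twentyeight_four
  · exact stampLawAt_twentynine_four
  · exact stampLawAt_thirty_four
  · exact stampLawAt_thirtyone_four
  · exact stampLawAt_thirtytwo_four
  · exact stampLawAt_thirtythree_four
  · exact stampLawAt_thirtyfour_four
  · exact stampLawAt_thirtyfive_four
  · exact stampLawAt_thirtysix_four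
  · exact stampLawAt_thirtyseven_four
  · exact stampLawAt_thirtyeight_four
  · exact stampLawAt_thirtynine_four
  · exact stampLawAt_forty_four
  · exact stampLawAt_fortyone_four
  · exact stampLawAt_fortytwo_four
  · exact stampLawAt_fortythree_four
  · exact stampLawAt_fortyfour_four
  · exact stampLawAt_fortyfive_four
  · exact stampLawAt_fortysix_four
  · exact stampLawAt_fortyseven_four
  · exact stampLawAt_fortyeight_four
  · exact stampLawAt_fortynine_four
  · exact stampLawAt_fifty_four
  · exact stampLawAt_fiftyone_four
  · exact stampLawAt_fiftytwo_four
  · exact stampLawAt_fiftythree_four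
  · exact stampLawAt_fiftyfour_four
  · exact stampLawAt_fiftyfive_four
  · exact stampLawAt_fiftysix_four
  · exact stampLawAt_fiftyseven_four
  · exact stampLawAt_fiftyeight_four
  · exact stampLawAt_fiftynine_four
  · exact stampLawAt_sixty_four

/-- **The `K = 5` column, sector register, to `m = 15`**: `η(m,5) ≤ 2·n(m,4)` for `2 ≤ m ≤ 15`. [folklore] -/
theorem hypRootLawAt_column_five'' (m : ℕ) (hm : 2 ≤ m) (hM : m ≤ 15) :
    HypRootLawAt m 5 (([24, 48, 88, 142, 228, 330, 468, 652, 854, 1094, 1416, 1746, 2188, 2766] : List ℕ).getD (m - 2) 0) := by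
  interval_cases m
  · exact hypRootLawAt_two_five_24
  · exact hypRootLawAt_three_five_48
  · exact hypRootLawAt_four_five_88
  · exact hypRootLawAt_five_five_142
  · exact hypRootLawAt_six_five_228
  · exact hypRootLawAt_seven_five_330
  · exact hypRootLawAt_eight_five_468
  · exact hypRootLawAt_nine_five_652
  · exact hypRootLawAt_ten_five_854
  · exact hypRootLawAt_eleven_five_1094
  · exact hypRootLawAt_twelve_five_1416
  · exact hypRootLawAt_thirteen_five_1746
  · exact hypRootLawAt_fourteen_five_2188
  · exact hypRootLawAt_fifteen_five_2766

/-- **The `K = 5` column, stamp register, to `m = 21`**: `ν(m,5) ≤ n(m,4)` for `2 ≤ m ≤ 21`. [folklore] -/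
theorem stampLawAt_column_five'' (m : ℕ) (hm : 2 ≤ m) (hM : m ≤ 21) :
    StampLawAt m 5 (([12, 24, 44, 71, 114, 165, 234, 326, 427, 547, 708, 873, 1094, 1383, 1650, 1935, 2304, 2782, 3324, 3812] : List ℕ).getD (m - 2) 0) := by
  interval_cases m
  · exact stampLawAt_two_five
  · exact stampLawAt_three_five
  · exact stampLawAt_four_five
  · exact stampLawAt_five_five
  · exact stampLawAt_six_five
  · exact stampLawAt_seven_five
  · exact stampLawAt_eight_five
  · exact stampLawAt_nine_five
  · exact stampLawAt_ten_five
  · exact stampLawAt_eleven_five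
  · exact stampLawAt_twelve_five
  · exact stampLawAt_thirteen_five
  · exact stampLawAt_fourteen_five
  · exact stampLawAt_fifteen_five
  · exact stampLawAt_sixteen_five
  · exact stampLawAt_seventeen_five
  · exact stampLawAt_eighteen_five
  · exact stampLawAt_nineteen_five
  · exact stampLawAt_twenty_five
  · exact stampLawAt_twentyone_five

/-- **The `K = 5` column, sector register, `17 ≤ m ≤ 19`** (the cell `m = 16` is not yet in the tree): `η(m,5) ≤ 2·n(m,4)`. [folklore] -/
theorem hypRootLawAt_column_five_upper (m : ℕ) (hm : 17 ≤ m) (hM : m ≤ 19) :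
    HypRootLawAt m 5 (([3870, 4608, 5564] : List ℕ).getD (m - 17) 0) := by
  interval_cases m
  · exact hypRootLawAt_seventeen_five_3870
  · exact hypRootLawAt_eighteen_five_4608
  · exact hypRootLawAt_nineteen_five_5564

/-- **The `K = 6` column, sector register, to `m = 8`**: `η(m,6) ≤ 2·n(m,5)` for `2 ≤ m ≤ 8`. [folklore] -/
theorem hypRootLawAt_column_six'' (m : ℕ) (hm : 2 ≤ m) (hM : m ≤ 8) :
    HypRootLawAt m 6 (([32, 72, 140, 252, 432, 690, 1024] : List ℕ).getD (m - 2) 0) := by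
  interval_cases m
  · exact hypRootLawAt_two_six_32
  · exact hypRootLawAt_three_six_72
  · exact hypRootLawAt_four_six_140
  · exact hypRootLawAt_five_six_252
  · exact hypRootLawAt_six_six_432
  · exact hypRootLawAt_seven_six_690
  · exact hypRootLawAt_eight_six_1024

/-- **The `K = 6` column, stamp register, to `m = 11`**: `ν(m,6) ≤ n(m,5)` for `2 ≤ m ≤ 11`. [folklore] -/
theorem stampLawAt_column_six'' (m : ℕ) (hm : 2 ≤ m) (hM : m ≤ 11) :
    StampLawAt m 6 (([16, 36, 70, 126, 216, 345, 512, 797, 1055, 1475] : List ℕ).getD (m - 2) 0) := by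
  interval_cases m
  · exact stampLawAt_two_six
  · exact stampLawAt_three_six
  · exact stampLawAt_four_six
  · exact stampLawAt_five_six
  · exact stampLawAt_six_six
  · exact stampLawAt_seven_six
  · exact stampLawAt_eight_six
  · exact stampLawAt_nine_six
  · exact stampLawAt_ten_six
  · exact stampLawAt_eleven_six

/-- **The `K = 7` column, stamp register, to `m = 6`**: `ν(m,7) ≤ n(m,6)` for `2 ≤ m ≤ 6`. [folklore] -/
theorem stampLawAt_column_seven' (m : ℕ) (hm : 2 ≤ m) (hM : m ≤ 6) :
    StampLawAt m 7 (([20, 52, 108, 211, 388] : List ℕ).getD (m - 2) 0) := by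
  interval_cases m
  · exact stampLawAt_two_seven
  · exact stampLawAt_three_seven
  · exact stampLawAt_four_seven
  · exact stampLawAt_five_seven
  · exact stampLawAt_six_seven

/-- **The `m = 2` row, stamp register, to `K = 13`**: `ν(2,K) ≤ n(2,K−1)` for `3 ≤ K ≤ 13` (OEIS A001212). [folklore] -/
theorem stampLawAt_row_two'' (K : ℕ) (hK : 3 ≤ K) (hKM : K ≤ 13) :
    StampLawAt 2 K (([4, 8, 12, 16, 20, 26, 32, 40, 46, 54, 64] : List ℕ).getD (K - 3) 0) := by
  interval_cases K
  · exact stampLawAt_two_three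
  · exact stampLawAt_two_four
  · exact stampLawAt_two_five
  · exact stampLawAt_two_six
  · exact stampLawAt_two_seven
  · exact stampLawAt_two_eight
  · exact stampLawAt_two_nine
  · exact stampLawAt_two_ten
  · exact stampLawAt_two_eleven
  · exact stampLawAt_two_twelve
  · exact stampLawAt_two_thirteen

end Summit.ValiantsHypothesis.ValiantsHypothesis.Theorems.LacunarySymmetroidMatrixDescartes.FiniteSector
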